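import Summits.KontsevichZagierPeriods.KontsevichZagierPeriods.Theses.HermiteRigidity
import Summits.KontsevichZagierPeriods.KontsevichZagierPeriods.Theorems.HermiteRigidityCMTwistQuasiPeriodTransferIsogeny
import Summits.KontsevichZagierPeriods.KontsevichZagierPeriods.Theorems.HermiteRigidityCMTwistQuasiPeriodTransferMoves

/-!
# `CMTwistQuasiPeriodTransfer` (stmt-KontsevichZagierPeriods-3416, route HermiteRigidity)

Closing file. On the CM curve `y² = f(x) = 4x³ − 120x + 224` (`j = 8000`, CM by `ℤ[√−2]`; roots
`e₃ = −2 − 3√2 < e₂ = −2 + 3√2 < e₁ = 4`) the second-kind CM relation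
`∫_{e₂}^{4} x dx/√(−f) = √2 ∫_{e₃}^{e₂} dx/√f − (1/√2)∫_{e₃}^{e₂} x dx/√f` (Masser 1975, Lemma 3.1)
is DERIVED inside the Kontsevich–Zagier calculus: for all representations `r = [σ′, x/√(−f)]`,
`s = [σ, √2/√f]`, `t = [σ, −x/(√2√f)]` (`σ = (e₃, e₂)`, `σ′ = (e₂, 4)`),
`[r] − [s] − [t] ∈ KZ.relations`. The chain (nine move instances):

1. `[r] = 2·[σ′, x/(2√(−f))]` (rule 1b);
2. with the real isogeny `ψ(x) = −x/2 − 9/(x − 4)` (`f ∘ ψ = −f·ψ′²/2`,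
   `HermiteRigidityCMTwistQuasiPeriodTransferIsogeny.lean`), which maps each half `(e₃, m)`,
   `(m, e₂)` (`m = 4 − 3√2`) of `σ` bijectively onto `σ′`, two change-of-variables moves (rule 2)
   give `[half, ψ/(√2√f)] ∼ [σ′, x/(2√(−f))]`;
3. the two halves glue to `[σ, ψ/(√2√f)]` (rule 1a at the algebraic abscissa `m`);
4. `[σ, √2/√f − x/(√2√f)] = [σ, ψ/(√2√f)] + [σ, (x² − 8x − 2)/(2(4 − x)√2√f)]` and
   `[σ, √2/√f − x/(√2√f)] = [s] + [t]` (rule 1b twice);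
5. the last summand is the exact form `d(√f/(4√2(4 − x)))`, whose primitive is `ℚ`-semialgebraic,
   continuous on `[e₃, e₂]` and vanishes at both roots: ONE Newton–Leibniz move (rule 3) plus the
   discarding of the two null endpoints (rule 1a) make it a relation
   (`of_mem_relations_of_hasDerivAt`, `HermiteRigidityCMTwistQuasiPeriodTransferMoves.lean`).

`CMTwistQuasiPeriodTransfer_proof` concludes the route declaration
`Summit.KontsevichZagierPeriods.KontsevichZagierPeriods.Theses.HermiteRigidity.CMTwistQuasiPeriodTransfer`
by name. No evaluation of integrals is used: integrability of every intermediate integrand is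
inherited from the hypotheses `r, s, t`.

References: M. Kontsevich, D. Zagier, *Periods* (2001), §1.2 rules (1)–(3); D. Masser,
*Elliptic Functions and Transcendence* (1975), Lemma 3.1; J. H. Silverman, *Advanced Topics in the
Arithmetic of Elliptic Curves* (1994), Prop. II.2.3.1.
-/

noncomputable section

open Set MeasureTheory MvPolynomial
open Literature.NumberTheory.Transcendental Literature.ModelTheory.ExponentialFields

namespace Summit.KontsevichZagierPeriods.HermiteRigidity.CMTwistQuasiPeriodTransfer

/-! ### The algebraic constants -/

/-- The constants of the chain are real algebraic: `√2`, `e₃ = −2 − 3√2`, `e₂ = −2 + 3√2` and the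
critical point `m = 4 − 3√2` of `ψ`. [folklore] -/
theorem isAlgebraic_constants : IsAlgebraic ℚ (Real.sqrt 2) ∧
    IsAlgebraic ℚ (-2 - 3 * Real.sqrt 2 : ℝ) ∧ IsAlgebraic ℚ (-2 + 3 * Real.sqrt 2 : ℝ) ∧
    IsAlgebraic ℚ (4 - 3 * Real.sqrt 2 : ℝ) := by
  have hs : IsAlgebraic ℚ (Real.sqrt 2) := by
    refine ⟨Polynomial.X ^ 2 - Polynomial.C 2, Polynomial.X_pow_sub_C_ne_zero two_pos 2, ?_⟩
    simp [Real.sq_sqrt (by norm_num : (0:ℝ) ≤ 2)]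
  have h2 : IsAlgebraic ℚ (2 : ℝ) := by exact_mod_cast isAlgebraic_nat (R := ℚ) (A := ℝ) 2
  have h3 : IsAlgebraic ℚ (3 : ℝ) := by exact_mod_cast isAlgebraic_nat (R := ℚ) (A := ℝ) 3
  have h4 : IsAlgebraic ℚ (4 : ℝ) := by exact_mod_cast isAlgebraic_nat (R := ℚ) (A := ℝ) 4
  exact ⟨hs, h2.neg.sub (h3.mul hs), h2.neg.add (h3.mul hs), h4.sub (h3.mul hs)⟩

/-! ### The two domains as intervals -/

/-- `σ = {0 < f(x), x < 4} = (e₃, e₂)`. [folklore] -/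
theorem sigma_eq : {p : Fin 1 → ℝ | 0 < 4 * p 0 ^ 3 - 120 * p 0 + 224 ∧ p 0 < 4} =
    {p | -2 - 3 * Real.sqrt 2 < p 0 ∧ p 0 < -2 + 3 * Real.sqrt 2} := by
  ext p
  simp only [mem_setOf_eq]
  constructor
  · rintro ⟨h1, h2⟩
    exact (f_pos_iff h2).mp h1
  · intro h
    have h4 : p 0 < 4 := h.2.trans roots_order.2.2.1
    exact ⟨(f_pos_iff h4).mpr h, h4⟩

/-- `σ′ = {f(x) < 0, 0 < x} = (e₂, 4)`. [folklore] -/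
theorem sigma'_eq : {p : Fin 1 → ℝ | 4 * p 0 ^ 3 - 120 * p 0 + 224 < 0 ∧ 0 < p 0} =
    {p | -2 + 3 * Real.sqrt 2 < p 0 ∧ p 0 < 4} := by
  ext p
  simp only [mem_setOf_eq]
  constructor
  · rintro ⟨h1, h2⟩
    exact (f_neg_iff h2).mp h1
  · intro h
    have h0 : 0 < p 0 := roots_order.2.2.2.trans h.1
    exact ⟨(f_neg_iff h0).mpr h, h0⟩

/-! ### Semialgebraicity and integrability of the intermediate integrands -/

/-- `p ↦ ψ(p 0)` is `ℚ`-semialgebraic on every `ℚ`-semialgebraic `σ ⊆ ℝ¹` avoiding `x = 4`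
(a quotient of polynomials). [cite: BochnakCosteRoy1998, §2.2] -/
theorem psi_isSemialgebraicFunOn {σ : Set (Fin 1 → ℝ)} (hσ : IsSemialgebraic ℚ σ)
    (h4 : ∀ p ∈ σ, p 0 ≠ 4) :
    IsSemialgebraicFunOn ℚ σ (fun p => -(p 0) / 2 - 9 / (p 0 - 4)) := by
  have h := isSemialgebraicFunOn_aeval_div_aeval hσ
    (-(X 0) * (X 0 - 4) - 18 : MvPolynomial (Fin 1) ℚ) (2 * (X 0 - 4)) (fun p hp => by
      simp only [map_mul, map_sub, aeval_X, map_ofNat]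
      exact mul_ne_zero two_ne_zero (sub_ne_zero.mpr (h4 p hp)))
  refine h.congr fun p hp => ?_
  have : (p 0 - 4) ≠ 0 := sub_ne_zero.mpr (h4 p hp)
  simp only [map_mul, map_sub, aeval_X, map_ofNat, map_neg]
  field_simp
  ring

/-- The transferred integrand `p ↦ ψ(p 0)/(√2 √f(p 0))` is `ℚ`-semialgebraic on every
`ℚ`-semialgebraic `σ ⊆ ℝ¹` avoiding `x = 4`. [cite: BochnakCosteRoy1998, Prop. 2.2.6] -/
theorem g_isSemialgebraicFunOn {σ : Set (Fin 1 → ℝ)} (hσ : IsSemialgebraic ℚ σ)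
    (h4 : ∀ p ∈ σ, p 0 ≠ 4) :
    IsSemialgebraicFunOn ℚ σ (fun p => (-(p 0) / 2 - 9 / (p 0 - 4)) /
      (Real.sqrt 2 * Real.sqrt (4 * p 0 ^ 3 - 120 * p 0 + 224))) := by
  have hc : IsSemialgebraicFunOn ℚ σ (fun _ => Real.sqrt 2) :=
    isSemialgebraicFunOn_const_of_isAlgebraic hσ isAlgebraic_constants.1
  have hf : IsSemialgebraicFunOn ℚ σ (fun p => Real.sqrt (4 * p 0 ^ 3 - 120 * p 0 + 224)) :=
    ((isSemialgebraicFunOn_aeval hσ (4 * X 0 ^ 3 - 120 * X 0 + 224 : MvPolynomial (Fin 1) ℚ)).congr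
      fun p _ => by simp [map_ofNat]).fun_sqrt
  exact ((psi_isSemialgebraicFunOn hσ h4).fun_mul ((hc.fun_mul hf).fun_inv)).congr
    fun p _ => by simp only [div_eq_mul_inv]

/-- The Hermite-type primitive `p ↦ √f(p 0)/(4√2(4 − p 0))` is `ℚ`-semialgebraic on every
`ℚ`-semialgebraic `σ ⊆ ℝ¹` contained in `{x < 4}`. [cite: BochnakCosteRoy1998, Prop. 2.2.6] -/
theorem F_isSemialgebraicFunOn {σ : Set (Fin 1 → ℝ)} (hσ : IsSemialgebraic ℚ σ)
    (h4 : ∀ p ∈ σ, p 0 < 4) :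
    IsSemialgebraicFunOn ℚ σ (fun p => Real.sqrt (4 * p 0 ^ 3 - 120 * p 0 + 224) /
      (4 * Real.sqrt 2 * (4 - p 0))) := by
  have hf : IsSemialgebraicFunOn ℚ σ (fun p => Real.sqrt (4 * p 0 ^ 3 - 120 * p 0 + 224)) :=
    ((isSemialgebraicFunOn_aeval hσ (4 * X 0 ^ 3 - 120 * X 0 + 224 : MvPolynomial (Fin 1) ℚ)).congr
      fun p _ => by simp [map_ofNat]).fun_sqrt
  have hc : IsSemialgebraicFunOn ℚ σ (fun _ => 4 * Real.sqrt 2) :=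
    (isSemialgebraicFunOn_const_ofNat hσ 4).fun_mul
      (isSemialgebraicFunOn_const_of_isAlgebraic hσ isAlgebraic_constants.1)
  have hl : IsSemialgebraicFunOn ℚ σ (fun p => 4 - p 0) :=
    (isSemialgebraicFunOn_aeval hσ (4 - X 0 : MvPolynomial (Fin 1) ℚ)).congr
      fun p _ => by simp [map_ofNat]
  refine IsSemialgebraicFunOn.div hf (hc.fun_mul hl) fun p hp => ?_
  have := (Real.sqrt_pos.mpr zero_lt_two : 0 < Real.sqrt 2)
  have : 0 < 4 - p 0 := by linarith [h4 p hp]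
  positivity

/-- Integrability of `(ψ/2)·(√2/√f)` on a measurable `σ ⊆ (a, b)`, `b < 4`, from that of `√2/√f`:
`ψ/2` is continuous on the compact box `[a, b]` (`IntegrableOn.continuousOn_mul_of_subset`).
[folklore] -/
theorem integrableOn_psi_mul {σ : Set (Fin 1 → ℝ)} (hσm : MeasurableSet σ) {a b : ℝ}
    (hb : b < 4) (hσab : σ ⊆ {p | a < p 0 ∧ p 0 < b})
    (hint : IntegrableOn (fun p : Fin 1 → ℝ =>
      Real.sqrt 2 / Real.sqrt (4 * p 0 ^ 3 - 120 * p 0 + 224)) σ) :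
    IntegrableOn (fun p : Fin 1 → ℝ => (-(p 0) / 2 - 9 / (p 0 - 4)) / 2 *
      (Real.sqrt 2 / Real.sqrt (4 * p 0 ^ 3 - 120 * p 0 + 224))) σ := by
  have hK : IsCompact (Icc (fun _ : Fin 1 => a) (fun _ => b)) := isCompact_Icc
  have hσK : σ ⊆ Icc (fun _ : Fin 1 => a) (fun _ => b) := by
    intro p hp
    obtain ⟨h1, h2⟩ := hσab hp
    exact ⟨fun i => by rw [Fin.fin_one_eq_zero i]; exact h1.le,
      fun i => by rw [Fin.fin_one_eq_zero i]; exact h2.le⟩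
  have hcont : ContinuousOn (fun p : Fin 1 → ℝ => (-(p 0) / 2 - 9 / (p 0 - 4)) / 2)
      (Icc (fun _ : Fin 1 => a) (fun _ => b)) := by
    have h4 : ∀ p ∈ Icc (fun _ : Fin 1 => a) (fun _ => b), p 0 - 4 ≠ 0 := by
      intro p hp
      have : p 0 ≤ b := hp.2 0
      exact ne_of_lt (by linarith)
    refine ContinuousOn.div_const (ContinuousOn.sub (by fun_prop) ?_) 2
    exact ContinuousOn.div continuousOn_const (by fun_prop) h4
  exact hint.continuousOn_mul_of_subset hcont hK hσm hσK

/-! ### The chain of moves -/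

/-- **The derivation** (explicit domains): for `r = [(e₂, 4) = {f < 0, 0 < x}, x/√(−f)]`,
`s = [(e₃, e₂) = {0 < f, x < 4}, √2/√f]`, `t = [(e₃, e₂), −x/(√2√f)]` one has
`[r] − [s] − [t] ∈ KZ.relations`, by the nine-move chain described in the module docstring.
[cite: KontsevichZagier2001, §1.2 rules (1)–(3)] -/
theorem of_sub_of_sub_of_mem_relations (r s t : KZ.IntegralRep 1)
    (hrd : r.domain = {p | 4 * p 0 ^ 3 - 120 * p 0 + 224 < 0 ∧ 0 < p 0})
    (hri : EqOn r.integrand (fun p => p 0 / Real.sqrt (-(4 * p 0 ^ 3 - 120 * p 0 + 224)))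
      {p | 4 * p 0 ^ 3 - 120 * p 0 + 224 < 0 ∧ 0 < p 0})
    (hsd : s.domain = {p | 0 < 4 * p 0 ^ 3 - 120 * p 0 + 224 ∧ p 0 < 4})
    (hsi : EqOn s.integrand (fun p => Real.sqrt 2 / Real.sqrt (4 * p 0 ^ 3 - 120 * p 0 + 224))
      {p | 0 < 4 * p 0 ^ 3 - 120 * p 0 + 224 ∧ p 0 < 4})
    (htd : t.domain = {p | 0 < 4 * p 0 ^ 3 - 120 * p 0 + 224 ∧ p 0 < 4})
    (hti : EqOn t.integrand
      (fun p => -p 0 / (Real.sqrt 2 * Real.sqrt (4 * p 0 ^ 3 - 120 * p 0 + 224)))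
      {p | 0 < 4 * p 0 ^ 3 - 120 * p 0 + 224 ∧ p 0 < 4}) :
    KZ.of r - KZ.of s - KZ.of t ∈ KZ.relations := by
  obtain ⟨h3m, hm2, h24, h02⟩ := roots_order
  -- the domains as intervals
  rw [← hsd] at hsi hti
  rw [← hrd] at hri
  have hsd' : s.domain = {p | -2 - 3 * Real.sqrt 2 < p 0 ∧ p 0 < -2 + 3 * Real.sqrt 2} :=
    hsd.trans sigma_eq
  have htd' : t.domain = s.domain := htd.trans hsd.symm
  have hrd' : r.domain = {p | -2 + 3 * Real.sqrt 2 < p 0 ∧ p 0 < 4} := hrd.trans sigma'_eq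
  have hσ : IsSemialgebraic ℚ s.domain := s.isSemialgebraic_domain
  have hσm : MeasurableSet s.domain := KZ.IntegralRep.measurableSet_domain_holds s
  have hmemσ : ∀ p ∈ s.domain, p 0 ∈ Ioo (-2 - 3 * Real.sqrt 2) (-2 + 3 * Real.sqrt 2) :=
    fun p hp => by rw [hsd'] at hp; exact hp
  have h4σ : ∀ p ∈ s.domain, p 0 ≠ 4 := fun p hp => ((hmemσ p hp).2.trans h24).ne
  have hfσ : ∀ p ∈ s.domain, 0 < 4 * p 0 ^ 3 - 120 * p 0 + 224 := fun p hp =>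
    f_pos_of_mem (hmemσ p hp)
  -- Step 1 (rule 1b): `[r] = 2 [σ′, x/(2√(−f))]`
  obtain ⟨rh, hrhd, hrhi⟩ : ∃ rh : KZ.IntegralRep 1, rh.domain = r.domain ∧
      rh.integrand = fun p => r.integrand p / 2 :=
    ⟨⟨r.domain, fun p => r.integrand p / 2, r.isSemialgebraic_domain,
      r.isSemialgebraicFunOn_integrand.div (isSemialgebraicFunOn_const_ofNat
        r.isSemialgebraic_domain 2) fun _ _ => two_ne_zero,
      r.integrableOn.div_const 2⟩, rfl, rfl⟩
  have R1 : KZ.of r - KZ.of rh - KZ.of rh ∈ KZ.integrandAddRel :=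
    ⟨1, r, rh, rh, hrhd, hrhd, fun p _ => by simp only [Pi.add_apply, hrhi]; ring, rfl⟩
  -- Step 2: the transferred representation `rσ = [σ, ψ/(√2√f)]`
  have hg_int : IntegrableOn (fun p : Fin 1 → ℝ => (-(p 0) / 2 - 9 / (p 0 - 4)) /
      (Real.sqrt 2 * Real.sqrt (4 * p 0 ^ 3 - 120 * p 0 + 224))) s.domain :=
    (integrableOn_psi_mul hσm h24 (fun p hp => hmemσ p hp)
      (s.integrableOn.congr_fun hsi hσm)).congr_fun (fun p hp => prod_identity (hfσ p hp)) hσm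
  obtain ⟨rσ, hrσd, hrσi⟩ : ∃ rσ : KZ.IntegralRep 1, rσ.domain = s.domain ∧
      rσ.integrand = fun p => (-(p 0) / 2 - 9 / (p 0 - 4)) /
        (Real.sqrt 2 * Real.sqrt (4 * p 0 ^ 3 - 120 * p 0 + 224)) :=
    ⟨⟨s.domain, _, hσ, g_isSemialgebraicFunOn hσ h4σ, hg_int⟩, rfl, rfl⟩
  -- Step 3 (rule 1a): split `σ` at the critical point `m = 4 − 3√2` of `ψ`
  have hA : IsSemialgebraic ℚ (rσ.domain ∩ {p | p 0 < 4 - 3 * Real.sqrt 2}) :=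
    rσ.isSemialgebraic_domain.inter (isSemialgebraic_setOf_apply_lt_of_isAlgebraic isAlgebraic_constants.2.2.2 0)
  have hB : IsSemialgebraic ℚ (rσ.domain ∩ {p | 4 - 3 * Real.sqrt 2 < p 0}) :=
    rσ.isSemialgebraic_domain.inter (isSemialgebraic_setOf_apply_gt_of_isAlgebraic isAlgebraic_constants.2.2.2 0)
  obtain ⟨rA, hrAd, hrAi⟩ : ∃ rA : KZ.IntegralRep 1,
      rA.domain = rσ.domain ∩ {p | p 0 < 4 - 3 * Real.sqrt 2} ∧ rA.integrand = rσ.integrand :=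
    ⟨rσ.restrict _ hA inter_subset_left, rfl, rfl⟩
  obtain ⟨rB, hrBd, hrBi⟩ : ∃ rB : KZ.IntegralRep 1,
      rB.domain = rσ.domain ∩ {p | 4 - 3 * Real.sqrt 2 < p 0} ∧ rB.integrand = rσ.integrand :=
    ⟨rσ.restrict _ hB inter_subset_left, rfl, rfl⟩
  have SPLIT : KZ.of rσ - KZ.of rA - KZ.of rB ∈ KZ.relations :=
    of_sub_of_sub_mem_relations_split rσ rA rB isAlgebraic_constants.2.2.2 hrAd hrBd
      (fun _ _ => by rw [hrAi]) (fun _ _ => by rw [hrBi])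
  have hAd : rA.domain = {p | p 0 ∈ Ioo (-2 - 3 * Real.sqrt 2) (4 - 3 * Real.sqrt 2)} := by
    rw [hrAd, hrσd, hsd']
    ext p
    simp only [mem_inter_iff, mem_setOf_eq, mem_Ioo]
    constructor
    · rintro ⟨⟨h1, -⟩, h3⟩; exact ⟨h1, h3⟩
    · rintro ⟨h1, h3⟩; exact ⟨⟨h1, h3.trans hm2⟩, h3⟩
  have hBd : rB.domain = {p | p 0 ∈ Ioo (4 - 3 * Real.sqrt 2) (-2 + 3 * Real.sqrt 2)} := by
    rw [hrBd, hrσd, hsd']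
    ext p
    simp only [mem_inter_iff, mem_setOf_eq, mem_Ioo]
    constructor
    · rintro ⟨⟨-, h2⟩, h3⟩; exact ⟨h3, h2⟩
    · rintro ⟨h3, h2⟩; exact ⟨⟨h3m.trans h3, h2⟩, h3⟩
  -- Step 4 (rule 2, twice): each half of `[σ, ψ/(√2√f)]` is the pull-back of `[σ′, x/(2√(−f))]`
  have hpull : ∀ p : Fin 1 → ℝ, p 0 ∈ Ioo (-2 - 3 * Real.sqrt 2) (-2 + 3 * Real.sqrt 2) →
      p 0 ≠ 4 - 3 * Real.sqrt 2 → -1 / 2 + 9 / (p 0 - 4) ^ 2 ≠ 0 →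
      rσ.integrand p = rh.integrand (fun _ => -(p 0) / 2 - 9 / (p 0 - 4)) *
        |-1 / 2 + 9 / (p 0 - 4) ^ 2| := by
    intro p hp hpm hd
    have hx4 : p 0 ≠ 4 := (hp.2.trans h24).ne
    have himg : (fun _ : Fin 1 => -(p 0) / 2 - 9 / (p 0 - 4)) ∈ r.domain := by
      rw [hrd']; exact ⟨e2_lt_psi hp hpm, psi_lt_four hp⟩
    simp only [hrσi, hrhi, hri himg]
    exact weight hx4 (f_pos_of_mem hp) hd
  have hmemA : ∀ p ∈ rA.domain, p 0 ∈ Ioo (-2 - 3 * Real.sqrt 2) (4 - 3 * Real.sqrt 2) :=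
    fun p hp => by rw [hAd] at hp; exact hp
  have hmemB : ∀ p ∈ rB.domain, p 0 ∈ Ioo (4 - 3 * Real.sqrt 2) (-2 + 3 * Real.sqrt 2) :=
    fun p hp => by rw [hBd] at hp; exact hp
  have COV_A : KZ.of rA - KZ.of rh ∈ KZ.changeOfVariablesRel := by
    refine of_sub_of_mem_changeOfVariablesRel_dimOne rA rh (fun x => -x / 2 - 9 / (x - 4))
      (fun x => -1 / 2 + 9 / (x - 4) ^ 2) ?_ (fun p hp => hasDerivAt_psi ?_) ?_ ?_ ?_
    · exact psi_isSemialgebraicFunOn rA.isSemialgebraic_domain fun p hp =>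
        (((hmemA p hp).2.trans hm2).trans h24).ne
    · exact (((hmemA p hp).2.trans hm2).trans h24).ne
    · intro p hp q hq h
      exact psi_injOn_left (hmemA p hp) (hmemA q hq) h
    · rw [hrhd, hrd', hAd, image_fin_one psi_image_left]
      rfl
    · intro p hp
      have hp' := hmemA p hp
      rw [hrAi]
      exact hpull p ⟨hp'.1, hp'.2.trans hm2⟩ hp'.2.ne (dpsi_neg hp'.2).ne
  have COV_B : KZ.of rB - KZ.of rh ∈ KZ.changeOfVariablesRel := by
    refine of_sub_of_mem_changeOfVariablesRel_dimOne rB rh (fun x => -x / 2 - 9 / (x - 4))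
      (fun x => -1 / 2 + 9 / (x - 4) ^ 2) ?_ (fun p hp => hasDerivAt_psi ?_) ?_ ?_ ?_
    · exact psi_isSemialgebraicFunOn rB.isSemialgebraic_domain fun p hp =>
        ((hmemB p hp).2.trans h24).ne
    · exact ((hmemB p hp).2.trans h24).ne
    · intro p hp q hq h
      exact psi_injOn_right (hmemB p hp) (hmemB q hq) h
    · rw [hrhd, hrd', hBd, image_fin_one psi_image_right]
      rfl
    · intro p hp
      have hp' := hmemB p hp
      rw [hrBi]
      exact hpull p ⟨h3m.trans hp'.1, hp'.2⟩ hp'.1.ne' (dpsi_pos hp').ne'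
  -- Step 5 (rule 1b, twice): `[s] + [t] = [σ, √2/√f − x/(√2√f)] = [σ, ψ/(√2√f)] + [σ, F′]`
  obtain ⟨u, hud, hui⟩ : ∃ u : KZ.IntegralRep 1, u.domain = s.domain ∧
      u.integrand = s.integrand + t.integrand :=
    ⟨⟨s.domain, s.integrand + t.integrand, hσ, IsSemialgebraicFunOn.add_holds
      s.isSemialgebraicFunOn_integrand (htd' ▸ t.isSemialgebraicFunOn_integrand),
      s.integrableOn.add (htd' ▸ t.integrableOn)⟩, rfl, rfl⟩
  have INT1 : KZ.of u - KZ.of s - KZ.of t ∈ KZ.integrandAddRel :=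
    ⟨1, u, s, t, hud.symm, htd'.trans hud.symm, fun p _ => by rw [hui], rfl⟩
  obtain ⟨h, hhd, hhi⟩ : ∃ h : KZ.IntegralRep 1, h.domain = s.domain ∧
      h.integrand = u.integrand - rσ.integrand :=
    ⟨⟨s.domain, u.integrand - rσ.integrand, hσ, IsSemialgebraicFunOn.sub_holds
      (hud ▸ u.isSemialgebraicFunOn_integrand) (hrσd ▸ rσ.isSemialgebraicFunOn_integrand),
      (hud ▸ u.integrableOn).sub (hrσd ▸ rσ.integrableOn)⟩, rfl, rfl⟩
  have INT2 : KZ.of u - KZ.of rσ - KZ.of h ∈ KZ.integrandAddRel :=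
    ⟨1, u, rσ, h, hrσd.trans hud.symm, hhd.trans hud.symm, fun p _ => by
      simp only [hhi, Pi.add_apply, Pi.sub_apply]; ring, rfl⟩
  -- Step 6 (rule 3 + rule 1a): `[σ, F′]` is a relation, `F = √f/(4√2(4 − x))`
  have EXACT : KZ.of h ∈ KZ.relations := by
    refine of_mem_relations_of_hasDerivAt (h3m.trans hm2) isAlgebraic_constants.2.1 isAlgebraic_constants.2.2.1
      (fun y => Real.sqrt (4 * y ^ 3 - 120 * y + 224) / (4 * Real.sqrt 2 * (4 - y))) h
      (hhd.trans hsd') ?_ ?_ ?_ ?_ ?_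
    · exact F_isSemialgebraicFunOn h.isSemialgebraic_domain fun p hp =>
        (hmemσ p (hhd ▸ hp)).2.trans h24
    · refine ContinuousOn.div (Real.continuous_sqrt.comp (by fun_prop)).continuousOn
        (by fun_prop) fun y hy => ?_
      have : 0 < 4 - y := by linarith [hy.2]
      have := (Real.sqrt_pos.mpr zero_lt_two : 0 < Real.sqrt 2)
      positivity
    · intro p hp
      have hpσ : p ∈ s.domain := hhd ▸ hp
      obtain ⟨h1, h2⟩ := hmemσ p hpσ
      have hx4 : p 0 < 4 := h2.trans h24
      refine (hasDerivAt_F hx4 (hfσ p hpσ)).congr_deriv ?_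
      rw [hhi, Pi.sub_apply, hui, Pi.add_apply, hsi hpσ, hti (htd'.symm ▸ hpσ), hrσi]
      exact (integrand_identity hx4 (hfσ p hpσ)).symm
    · show Real.sqrt (4 * (-2 - 3 * Real.sqrt 2) ^ 3 - 120 * (-2 - 3 * Real.sqrt 2) + 224) /
        (4 * Real.sqrt 2 * (4 - (-2 - 3 * Real.sqrt 2))) = 0
      rw [f_e3, Real.sqrt_zero, zero_div]
    · show Real.sqrt (4 * (-2 + 3 * Real.sqrt 2) ^ 3 - 120 * (-2 + 3 * Real.sqrt 2) + 224) /
        (4 * Real.sqrt 2 * (4 - (-2 + 3 * Real.sqrt 2))) = 0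
      rw [f_e2, Real.sqrt_zero, zero_div]
  -- Step 7: bookkeeping in the formal group
  have key : KZ.of r - KZ.of s - KZ.of t = (KZ.of r - KZ.of rh - KZ.of rh) -
      (KZ.of rA - KZ.of rh) - (KZ.of rB - KZ.of rh) - (KZ.of rσ - KZ.of rA - KZ.of rB) -
      (KZ.of u - KZ.of rσ - KZ.of h) - KZ.of h + (KZ.of u - KZ.of s - KZ.of t) := by abel
  rw [key]
  refine KZ.relations.add_mem (KZ.relations.sub_mem (KZ.relations.sub_mem (KZ.relations.sub_mem
    (KZ.relations.sub_mem (KZ.relations.sub_mem (KZ.integrandAddRel_subset_relations R1)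
    (KZ.changeOfVariablesRel_subset_relations COV_A))
    (KZ.changeOfVariablesRel_subset_relations COV_B)) SPLIT)
    (KZ.integrandAddRel_subset_relations INT2)) EXACT) (KZ.integrandAddRel_subset_relations INT1)

/-- **`CMTwistQuasiPeriodTransfer`** (stmt-KontsevichZagierPeriods-3416): the second-kind CM
transfer `∫_{e₂}^{4} x dx/√(−f) = √2 ∫_{e₃}^{e₂} dx/√f − (1/√2)∫_{e₃}^{e₂} x dx/√f` on
`y² = 4x³ − 120x + 224` is derivable in the Kontsevich–Zagier calculus:
`[r] − [s] − [t] ∈ KZ.relations` for all representations `r, s, t` of the three integrals on the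
typed domains. [cite: KontsevichZagier2001, §1.2 rules (1)–(3)] -/
theorem CMTwistQuasiPeriodTransfer_proof :
    Summit.KontsevichZagierPeriods.KontsevichZagierPeriods.Theses.HermiteRigidity.CMTwistQuasiPeriodTransfer := by
  unfold Summit.KontsevichZagierPeriods.KontsevichZagierPeriods.Theses.HermiteRigidity.CMTwistQuasiPeriodTransfer
  intro f σ σ' r s t hrd hri hsd hsi htd hti
  exact of_sub_of_sub_of_mem_relations r s t hrd hri hsd hsi htd hti

end Summit.KontsevichZagierPeriods.HermiteRigidity.CMTwistQuasiPeriodTransfer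

end
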